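import Summits.MatrixMultiplication.MatrixMultiplication.Theses.WindowedCompletionRank

/-!
# MatrixMultiplication / WindowedCompletionRank — `WindowToThesis` (stmt-MatrixMultiplication-5500)

Route `WindowedCompletionRank`, support glue `WindowToThesis : WindowCompletion → Thesis`.

`WindowCompletion` (the window frame) supplies, for every `ε > 0`, a size `n ≥ 2`, a finite abelian
group `G` with `|G| ≤ n^(2+ε)`, maps `A B C : Fin n → G` and a completion `S : G → G → G → ℂ` with
`R(S) ≤ n^ε` such that the matrix multiplication tensor `⟨n,n,n⟩` EQUALS the window tensor
`fun a b c => [ (A b.1 - B b.2) + (B c.1 + C c.2) = A a.1 + C a.2 ] · S (A a.1 + C a.2) (A b.1 - B b.2) (B c.1 + C c.2)`.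
`Thesis` asks for index maps `α β γ : Fin n × Fin n → G` and `S` with `⟨n,n,n⟩` a RESTRICTION of the
windowed Hadamard product `fun a b c => [α b + β c = γ a] · S (γ a) (α b) (β c)`.

The glue is bookkeeping: take `α b = A b.1 - B b.2`, `β c = B c.1 + C c.2`, `γ a = A a.1 + C a.2`
(Cohn–Umans form); then the windowed Hadamard product is literally the window tensor, which equals
`⟨n,n,n⟩`, and restriction is reflexive (`TensorRestrictsTo.refl`). Source of the frame:
Cohn–Umans 2003 (group-theoretic approach; the maps `A(x) − B(y)`, `B(y) + C(z)`, `A(x) + C(z)`).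
-/

-- the tree's namespace `Summit.MatrixMultiplication.MatrixMultiplication.…` repeats a component by design
set_option linter.dupNamespace false

namespace Summit.MatrixMultiplication.MatrixMultiplication.Theorems

open Summit.MatrixMultiplication.MatrixMultiplication.Theses.WindowedCompletionRank
open Literature.Computability.AlgebraicComplexity

/-- **Glue `WindowToThesis`** (route WindowedCompletionRank, stmt-MatrixMultiplication-5500):
`WindowCompletion → Thesis` — a window-frame completion family is an instance of the graded
completion-rank thesis with `α b = A b.1 − B b.2`, `β c = B c.1 + C c.2`, `γ a = A a.1 + C a.2`,
the same `n`, `G`, `S`, and the identity restriction (`TensorRestrictsTo.refl`). -/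
theorem windowToThesis_proof :
    Summit.MatrixMultiplication.MatrixMultiplication.Theses.WindowedCompletionRank.WindowToThesis := by
  unfold WindowToThesis WindowCompletion Thesis
  intro hW ε hε
  obtain ⟨n, hn, G, instG, instF, instD, hcard, A, B, C, S, hS, hEq⟩ := hW ε hε
  refine ⟨n, hn, G, instG, instF, instD, hcard, fun b => A b.1 - B b.2, fun c => B c.1 + C c.2,
    fun a => A a.1 + C a.2, S, hS, ?_⟩
  rw [hEq]
  exact TensorRestrictsTo.refl _

end Summit.MatrixMultiplication.MatrixMultiplication.Theorems
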